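import Summits.QuantumFields.BalabanUV.T4Continuum.Support.T4TrajectoryDensityPerFamily
import Summits.QuantumFields.BalabanUV.T4Continuum.Support.T4TrajectoryDensityFreshStep

/-!
# `T4Continuum.T4TrajectoryDensityGated` — THE DRESSED BUDGET AS A GATE, DISCHARGED BY THE BOOKING'S OWN INDUCTION: the
# per-family capstone with its budget binder `hs` read UNDER THE HISTORY (so that, with the gate := the budget, `hs` is
# definitionally true), and the cumulative induction of `T4TrajectoryComparison` §10 re-run with an ENVELOPE-discharged gate,
# which the K-free smallness of the source strength turns into the budget — the scale-by-scale interleaving of the (w2-obs) line,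
# at booking level (cell `pub-balaban`, sub-cell `t4`, spine estimate NE1′ (node O3b/H2), lineage t4-ne1p-p1 = PROVER seat P1
# «RG-trajectory comparison», generation 22; tree target `Summits/QuantumFields/BalabanUV/T4Continuum/Support/`; ADDITIVE —
# imports `T4TrajectoryDensityPerFamily` and `T4TrajectoryDensityFreshStep` ONLY; modifies nothing)

HONEST FRAMING.  Finite four-torus, rung (B)+1 only — NOT infinite volume, NOT a mass gap, NOT the Clay problem, NOT summit
progress.  «continuum YM on T⁴ ⇐ BetaPertH ∧ nine spine estimates (0/9 proved); BetaPertH ⇐ (D1) ∧ (D4) ∧ CAP+tail; G-an2-4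
gates asym, D1 and NE2/3/4».  [folklore] kernel glue + one induction copied from `T4TrajectoryComparison.envBoundAtVar_ranBelow`
with the gate discharged from the ENVELOPE bound instead of the size bound; 0 sorry, 0 citations; nothing of Bałaban's densities
or the cell's D-terms is asserted — births, class compatibility, regeneration, the per-component weight data and the window
geometry stay binders ((w1), (w2-act), (w3)⁺, (w5), (w7)).

CONTENTS (§20 of the (w2)-split).
* `birthSlice_mono_bound`, `opSliceOn_mono_const` — monotonicity of the slice formats in their bound (to run the pipeline with
  the UNIFORM step constant `e³ ≥ e^{3(s⁰+s₁)}` off and on the history alike).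
* `transportsFromVar_of_centredExponent_lattice_fam_gated` — §19's per-family centred capstone with `hs` asked only UNDER
  `RanBelow Gate (k+1)` and the domination stated with `e³`: `e³·(1 + 4θ b k/ϱ b k′ k) ≤ α k`.
* `budgetGate T s⁰ m S C ρ k` — THE DRESSED BUDGET AT SCALE `k` AS A GATE: for every family `b` alive at `k`,
  `s⁰ b k + m·Σ_{f ∈ S k b} envVar C ρ f k ≤ 1` (`S k b` = the live families of `b`'s met component; `m` ∝ the source strength ×
  `4c_δ/r_*`; the envelope sum is §17's booked form of the fresh response).
* `budgetGate_of_envBound` — the envelope bound at scale `k` with a constant-rate class `σ j k ≤ A₀ρ₁^{k−j}τ^{K−j}`, positional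
  counts, the strict product `Λρ₁τ ≤ ρ′ < 1`, a per-step action margin and the K-FREE smallness `m·N₀A₀(1−ρ′)⁻¹ ≤ 1 − s̄⁰` GIVE
  the gate at `k` (`T4TrajectoryDensityFreshStep.freshProfile_inner_le` by name).
* `envBoundAtVar_ranBelow_envGate` — `T4TrajectoryComparison.envBoundAtVar_ranBelow` VERBATIM except that the gate of scale `k` is
  discharged from the ENVELOPE bound at `k` (which the induction holds) rather than from the size bound.
* `dressedBudget_closed` — composition: births-from-old + class compatibility + `TransportsFromVar C ρ (budgetGate …)` +
  regeneration + the data of `budgetGate_of_envBound` ⟹ for every `k ≤ K`: the envelope bound AND `RanBelow (budgetGate …) k` —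
  EVERY DRESSED BUDGET ALONG THE TRAJECTORY HOLDS, K-free.  The `TransportsFromVar` input is exactly what the gated capstone
  delivers with `Gate := budgetGate …` and `s₁ b k := m·Σ envVar`, its `hs` being the gate itself (`hs_of_budgetGate`).
WHAT REMAINS A BINDER of the gated capstone (function level): `hP` — the centred perturbation slice of the component's
observable-attached exponent with size `m·Σ_{f∈S k b} envVar C ρ f k` under the history; §10 (`pertSlice_fresh`) + §15
(`birthSlice_iterate`, horizon = the history) + §17 (`envelopeResponse_of_booking`'s size bookkeeping) supply it generation by
generation; assembling those three under `RanBelow` over all live families of a component is routine but long, and is left to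
the instantiating seat together with the window geometry (w3)⁺.
-/

namespace Summit.QuantumFields.BalabanUV.T4Continuum.T4TrajectoryDensityDressed

open MeasureTheory Set Metric Filter Finset
open Literature.MathematicalPhysics.QuantumFieldTheory.Balaban1983to89
open T4TermFormat T4TermFormat.Booking T4GatedBooking T4TrajectoryComparison T4TrajectoryModulus
open T4BirthChartTransport (GaugeInvariant BirthSlice RelGauge)
open T4BlockTransport (Fld NDir latMove latN latMove_zero)
open T4TrajectoryDensity

noncomputable section

/-! ## §20a Monotonicity of the slice formats in their bound [folklore] -/

section Mono

variable {𝒰 Dir F : Type*} [NormedAddCommGroup F] [NormedSpace ℂ F]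
variable {move : 𝒰 → Dir → ℂ → 𝒰} {N : Dir → ℝ} {w r : ℝ}

/-- A birth slice with bound `A` is one with any larger bound. [folklore] -/
theorem birthSlice_mono_bound {Fn : 𝒰 → F} {𝒦 : Set 𝒰} {A A' : ℝ} (h : BirthSlice Fn move N 𝒦 w r A) (hA : A ≤ A') :
    BirthSlice Fn move N 𝒦 w r A' := by
  intro U hU d hd hdw
  obtain ⟨Dm, hdiff, hbd, hD⟩ := h U hU d hd hdw
  exact ⟨Dm, hdiff, fun t ht => (hbd t ht).trans hA, hD⟩

/-- An operator slice on a class with constant `a` is one with any larger constant (fluctuation domain non-empty, so that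
the sup bounds `m` it is tested on are `≥ 0`). [folklore] -/
theorem opSliceOn_mono_const {Z : Type*} {𝒢 : Set (Z → F)} {E : 𝒰 → (Z → F) → F} {D : Set Z} {𝒦 : Set 𝒰} {ϱ a a' : ℝ}
    (hD : D.Nonempty) (h : OpSliceOn 𝒢 E D move N 𝒦 w ϱ a) (ha : a ≤ a') : OpSliceOn 𝒢 E D move N 𝒦 w ϱ a' := by
  intro g hg m hm
  obtain ⟨z, hz⟩ := hD
  have hm0 : 0 ≤ m := (norm_nonneg _).trans (hm z hz)
  exact birthSlice_mono_bound (h g hg m hm) (mul_le_mul_of_nonneg_right ha hm0)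

end Mono

/-! ## §20b The per-family centred capstone with the budget read UNDER THE HISTORY [folklore] -/

section GatedCapstone

variable {B : Booking} {T : Trajectory B}
variable {R : Type*} [NormedRing R] [NormedAlgebra ℂ R] [MeasurableSpace R] {d : ℕ}
  {F : Type*} [NormedAddCommGroup F] [NormedSpace ℂ F] [CompleteSpace F]

/-- **THE PER-FAMILY CENTRED CAPSTONE, BUDGET UNDER THE HISTORY** — `transportsFromVar_of_centredExponent_lattice_fam` VERBATIM
except: `hs` is asked only under `RanBelow Gate (k+1)` (the budget of step `k` is part of what the history certifies), and the
domination is stated with the uniform step constant `e³` (`e^{3(s b k + s₁ b k)} ≤ e³` under the budget; `opSliceOn_mono_const`).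
SAME conclusion. [folklore] -/
theorem transportsFromVar_of_centredExponent_lattice_fam_gated {Gate : ℕ → Prop} {Fn : B.Birth → ℕ → ℕ → Fld d R → F}
    {rel : B.Birth → ℕ → ℕ → Fld d R → Fld d R → Prop} {𝒦 : B.Birth → ℕ → ℕ → Set (Fld d R)}
    {ref : B.Birth → ℕ → Fld d R → Fld d R} {base : B.Birth → ℕ → Fld d R → ℝ}
    {𝒜 𝒬 : B.Birth → ℕ → Fld d R → Fld d R → ℂ} {q : B.Birth → ℕ → Fld d R → ℂ}
    {μ : B.Birth → ℕ → Measure (Fld d R)} {z₀ : B.Birth → ℕ → Fld d R} {D : B.Birth → ℕ → Set (Fld d R)}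
    {defect : B.Birth → ℕ → ℕ → ℝ} {cδ ψ w r : ℝ} {s s₁ θ : B.Birth → ℕ → ℝ} {α : ℕ → ℝ}
    {ϱ : B.Birth → ℕ → ℕ → ℝ}
    (hα : ∀ i, 0 ≤ α i) (hr : 0 < r) (hw : 0 < w)
    (hsl : ∀ (b : B.Birth) (k' : ℕ), B.birthScale b ≤ k' → k' ≤ B.K → RanBelow Gate k' →
      BirthSlice (Fn b k' k') latMove latN (𝒦 b k' k') w r (T.gen b k'))
    (hFn : ∀ (b : B.Birth) (k' k : ℕ), B.birthScale b ≤ k' → k' ≤ k → k + 1 ≤ B.K → RanBelow Gate (k + 1) →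
      ∀ U, Fn b k' (k + 1) U =
        wOp (expWeight (base b k) (𝒜 b k + 𝒬 b k)) (μ b k) (z₀ b k) U (fun z => Fn b k' k (U + z)))
    (h𝒢 : ∀ (b : B.Birth) (k' k : ℕ), B.birthScale b ≤ k' → k' ≤ k → k + 1 ≤ B.K → RanBelow Gate (k + 1) →
      ∀ U, (fun z => Fn b k' k (U + z)) ∈ BddClass F (μ b k))
    (hD : ∀ b k, (D b k).Nonempty) (hϱ : ∀ b k' k, 0 < ϱ b k' k)
    (hB : ∀ (b : B.Birth) (k' k : ℕ), B.birthScale b ≤ k' → k' ≤ k → k + 1 ≤ B.K → RanBelow Gate (k + 1) →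
      RealBaseAt (ref b k) (base b k) (𝒜 b k) (μ b k) (𝒦 b k' (k + 1)))
    (hE : ∀ (b : B.Birth) (k' k : ℕ), B.birthScale b ≤ k' → k' ≤ k → k + 1 ≤ B.K → RanBelow Gate (k + 1) →
      ExponentSliceAt (ref b k) (𝒜 b k) (μ b k) latMove latN (𝒦 b k' (k + 1)) w (ϱ b k' k) (s b k))
    (hP : ∀ (b : B.Birth) (k' k : ℕ), B.birthScale b ≤ k' → k' ≤ k → k + 1 ≤ B.K → RanBelow Gate (k + 1) →
      PertSlice (fun U z => 𝒬 b k U z - q b k U) (μ b k) latMove latN (𝒦 b k' (k + 1)) w (ϱ b k' k) (s₁ b k))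
    (hs : ∀ (b : B.Birth) (k' k : ℕ), B.birthScale b ≤ k' → k' ≤ k → k + 1 ≤ B.K → RanBelow Gate (k + 1) →
      s b k + s₁ b k ≤ 1)
    (hDμ : ∀ b k, ∀ᵐ z ∂μ b k, z ∈ D b k)
    (hN1 : ∀ (b : B.Birth) (k' k : ℕ), B.birthScale b ≤ k' → k' ≤ k → k + 1 ≤ B.K →
      ∀ z ∈ D b k, ∀ U ∈ 𝒦 b k' (k + 1), U + z ∈ 𝒦 b k' k)
    (hN2 : ∀ (b : B.Birth) (k' k : ℕ), B.birthScale b ≤ k' → k' ≤ k → k + 1 ≤ B.K →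
      ∀ U₀ ∈ 𝒦 b k' (k + 1), ∀ p : NDir d R, latN p ≤ w → ∀ z' ∈ D b k, latMove U₀ p 1 + z' ∈ 𝒦 b k' k)
    (hdiam : ∀ b k, ∀ z ∈ D b k, ∀ z' ∈ D b k, ∀ x ν, ‖z x ν - z' x ν‖ ≤ θ b k)
    (hθ : ∀ b k, 0 < θ b k ∧ θ b k ≤ w)
    (hdom : ∀ (b : B.Birth) (k' k : ℕ), B.birthScale b ≤ k' → k' ≤ k → k + 1 ≤ B.K →
      Real.exp 3 * (1 + 4 * θ b k / ϱ b k' k) ≤ α k)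
    (hinv : ∀ b k' k, GaugeInvariant (rel b k' k) (Fn b k' k))
    (hdefw : ∀ b k' k, defect b k' k ≤ w)
    (hrate : ∀ (b : B.Birth) (k' k : ℕ), B.birthScale b ≤ k' → k' ≤ k → k ≤ B.K →
      defect b k' k ≤ cδ * ψ ^ (k - k'))
    (hlin : ∀ (b : B.Birth) (k' k : ℕ), B.birthScale b ≤ k' → k' ≤ k → k ≤ B.K → RanBelow Gate k → ∀ ε > 0,
      ∃ U₀ ∈ 𝒦 b k' k, ∃ U₁ : Fld d R, RelGauge (rel b k' k) latMove latN U₀ U₁ (defect b k' k) ∧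
        T.lin b k' k ≤ ‖Fn b k' k U₁ - Fn b k' k U₀‖ + ε) :
    T.TransportsFromVar (4 * cδ / r) (fun i => ψ * α i) Gate := by
  have e : ∀ b k, 𝒜 b k + 𝒬 b k = (𝒜 b k + fun U z => 𝒬 b k U z - q b k U) + fun U _ => q b k U := fun b k => by
    funext U z
    simp only [Pi.add_apply]
    ring
  have hFn' : ∀ (b : B.Birth) (k' k : ℕ), B.birthScale b ≤ k' → k' ≤ k → k + 1 ≤ B.K → RanBelow Gate (k + 1) →
      ∀ U, Fn b k' (k + 1) U =
        wOp (expWeight (base b k) (𝒜 b k + fun U z => 𝒬 b k U z - q b k U)) (μ b k) (z₀ b k) U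
          (fun z => Fn b k' k (U + z)) := by
    intro b k' k h₁ h₂ h₃ h₄ U
    rw [hFn b k' k h₁ h₂ h₃ h₄ U, e b k, wOp_expWeight_add_zconst]
  exact transportsFromVar_of_linearOpSlicesOn_lattice_fam (𝒢 := fun b k => BddClass F (μ b k))
    (E := fun b k => wOp (expWeight (base b k) (𝒜 b k + fun U z => 𝒬 b k U z - q b k U)) (μ b k) (z₀ b k))
    (a := fun _ _ => Real.exp 3) (ϱ := ϱ) (θ := θ)
    hα hr hw hsl hFn' h𝒢 hD hϱ (fun b k c => const_mem_bddClass (μ b k) c)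
    (fun b k _ hg _ hg' => sub_mem_bddClass hg hg')
    (fun b k U _ hg _ hg' => wOp_sub _ (μ b k) (z₀ b k) U hg hg')
    (fun b k U c => wOp_const _ (μ b k) (z₀ b k) U c)
    (fun b k' k hbk' hk'k hk hran =>
      opSliceOn_mono_const (hD b k)
        (opSliceOn_wOp_dressed (z₀ b k) (hB b k' k hbk' hk'k hk hran) (hE b k' k hbk' hk'k hk hran)
          (hP b k' k hbk' hk'k hk hran) (hs b k' k hbk' hk'k hk hran) (hDμ b k))
        (Real.exp_le_exp.mpr (by linarith [hs b k' k hbk' hk'k hk hran])))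
    hN1 hN2 hdiam hθ hdom hinv hdefw hrate hlin

end GatedCapstone

/-! ## §20c The dressed budget as a gate; its discharge from the envelope bound; the closed induction [folklore] -/

section BudgetGate

variable {B : Booking} {T : Trajectory B}

/-- **THE DRESSED BUDGET AT SCALE `k` AS A GATE**: every family `b` alive at `k` has `s⁰ b k + m·Σ_{f ∈ S k b} envVar C ρ f k ≤ 1`
(`S k b` = the live families of `b`'s met component; the envelope sum is the booked form of the component's fresh response,
`T4TrajectoryDensityFreshBooking`; `m` ∝ source strength × `4c_δ/r_*`). [folklore] -/
def budgetGate (T : Trajectory B) (s₀ : B.Birth → ℕ → ℝ) (m : ℝ) (S : ℕ → B.Birth → Finset B.Birth) (C : ℝ) (ρ : ℕ → ℝ)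
    (k : ℕ) : Prop :=
  ∀ b : B.Birth, B.birthScale b ≤ k → s₀ b k + m * ∑ f ∈ S k b, T.envVar C ρ f k ≤ 1

/-- With the gate := the budget, the gated capstone's `hs` binder (for the sizes `s₁ b k := m·Σ envVar`) IS the history: nothing
to supply. [folklore] -/
theorem hs_of_budgetGate {s₀ : B.Birth → ℕ → ℝ} {m C : ℝ} {S : ℕ → B.Birth → Finset B.Birth} {ρ : ℕ → ℝ} :
    ∀ (b : B.Birth) (k' k : ℕ), B.birthScale b ≤ k' → k' ≤ k → k + 1 ≤ B.K →
      RanBelow (budgetGate T s₀ m S C ρ) (k + 1) →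
        s₀ b k + m * ∑ f ∈ S k b, T.envVar C ρ f k ≤ 1 :=
  fun b _ k hbk' hk'k _ hran => hran k (Nat.lt_succ_self k) b (hbk'.trans hk'k)

/-- **THE GATE FROM THE ENVELOPE BOUND** (booking-level form of §13/§17): at a scale `k ≤ K`, the envelope bound with a
constant-rate class `σ j k ≤ A₀·ρ₁^{k−j}·τ^{K−j}`, live families of birth scale `≤ k` counted by `≤ N₀Λ^{k−j}` per birth scale in
every component, `Λρ₁τ ≤ ρ′ < 1`, `0 ≤ τ ≤ 1`, a per-step action margin `s⁰ b k ≤ s̄⁰` and the K-FREE smallness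
`m·(N₀A₀(1−ρ′)⁻¹) ≤ 1 − s̄⁰` give the dressed budget at `k`. [folklore] -/
theorem budgetGate_of_envBound {s₀ : B.Birth → ℕ → ℝ} {m C : ℝ} {S : ℕ → B.Birth → Finset B.Birth} {ρ : ℕ → ℝ}
    {σ : ℕ → ℕ → ℝ} {A₀ ρ₁ τ Λ N₀ ρ' sbar : ℝ} {k : ℕ}
    (hm : 0 ≤ m) (hA₀ : 0 ≤ A₀) (hρ₁ : 0 ≤ ρ₁) (hτ0 : 0 ≤ τ) (hτ1 : τ ≤ 1) (hΛ : 0 ≤ Λ) (hN₀ : 0 ≤ N₀)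
    (hρ'1 : ρ' < 1) (hprod : Λ * ρ₁ * τ ≤ ρ') (hk : k ≤ B.K)
    (hS : ∀ b, ∀ f ∈ S k b, B.birthScale f ≤ k)
    (hcount : ∀ b, ∀ j ≤ k, (((S k b).filter fun f => B.birthScale f = j).card : ℝ) ≤ N₀ * Λ ^ (k - j))
    (hσ : ∀ j, j ≤ k → σ j k ≤ A₀ * ρ₁ ^ (k - j) * τ ^ (B.K - j))
    (hs₀ : ∀ b, s₀ b k ≤ sbar) (hsmall : m * (N₀ * A₀ * (1 - ρ')⁻¹) ≤ 1 - sbar)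
    (henv : T.EnvBoundAtVar C ρ σ k) :
    budgetGate T s₀ m S C ρ k := by
  intro b _
  set g : ℕ → ℝ := fun j => A₀ * ρ₁ ^ (k - j) * τ ^ (B.K - j) with hg
  have hg0 : ∀ j, 0 ≤ g j := fun j => by rw [hg]; positivity
  have hsum : ∑ f ∈ S k b, T.envVar C ρ f k ≤ N₀ * A₀ * (1 - ρ')⁻¹ := by
    have hregroup : ∑ f ∈ S k b, g (B.birthScale f) =
        ∑ j ∈ range (k + 1), (((S k b).filter fun f => B.birthScale f = j).card : ℝ) * g j := by
      classical
      rw [← sum_fiberwise_of_maps_to (s := S k b) (t := range (k + 1)) (g := B.birthScale)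
        (fun f hf => mem_range_succ_iff.mpr (hS b f hf)) (fun f => g (B.birthScale f))]
      refine sum_congr rfl fun j _ => ?_
      rw [sum_congr rfl (fun f hf => by rw [(mem_filter.mp hf).2] :
          ∀ f ∈ (S k b).filter (fun f => B.birthScale f = j), g (B.birthScale f) = g j), sum_const, nsmul_eq_mul]
    have hinner := freshProfile_inner_le (N₀ := N₀) (cδ := 1) (Ahat := A₀) (Λ := Λ) (φ := ρ₁) (τ := τ) (ρ := ρ')
      hN₀ zero_le_one hA₀ hΛ hρ₁ hτ0 hρ'1 hprod hk
    have hτpow : τ ^ (B.K - k) ≤ 1 := pow_le_one₀ hτ0 hτ1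
    calc ∑ f ∈ S k b, T.envVar C ρ f k ≤ ∑ f ∈ S k b, g (B.birthScale f) :=
          sum_le_sum fun f hf => (henv f (hS b f hf)).trans (by rw [hg]; exact hσ _ (hS b f hf))
      _ = ∑ j ∈ range (k + 1), (((S k b).filter fun f => B.birthScale f = j).card : ℝ) * g j := hregroup
      _ ≤ ∑ j ∈ range (k + 1), N₀ * Λ ^ (k - j) * g j :=
          sum_le_sum fun j hj => mul_le_mul_of_nonneg_right (hcount b j (mem_range_succ_iff.mp hj)) (hg0 j)
      _ = ∑ j ∈ range (k + 1), N₀ * Λ ^ (k - j) * (1 * ρ₁ ^ (k - j)) * (A₀ * τ ^ (B.K - j)) := by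
          refine sum_congr rfl fun j _ => ?_
          rw [hg]
          ring
      _ ≤ N₀ * 1 * A₀ * (1 - ρ')⁻¹ * τ ^ (B.K - k) := hinner
      _ ≤ N₀ * 1 * A₀ * (1 - ρ')⁻¹ * 1 := by
          refine mul_le_mul_of_nonneg_left hτpow ?_
          have : 0 ≤ (1 - ρ')⁻¹ := inv_nonneg.mpr (by linarith)
          positivity
      _ = N₀ * A₀ * (1 - ρ')⁻¹ := by ring
  calc s₀ b k + m * ∑ f ∈ S k b, T.envVar C ρ f k ≤ sbar + m * (N₀ * A₀ * (1 - ρ')⁻¹) :=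
        add_le_add (hs₀ b) (mul_le_mul_of_nonneg_left hsum hm)
    _ ≤ 1 := by linarith

/-- **THE CUMULATIVE INDUCTION WITH AN ENVELOPE-DISCHARGED GATE** — `T4TrajectoryComparison.envBoundAtVar_ranBelow` VERBATIM
except that the gate of scale `k < K` is discharged from the history and the ENVELOPE bound at `k` (which the induction
holds at that moment) instead of the size bound.  Births from old, class compatibility, transport under the gate, regeneration
under the gate: unchanged. [folklore] -/
theorem envBoundAtVar_ranBelow_envGate {C : ℝ} {ρ c : ℕ → ℝ} {σ : ℕ → ℕ → ℝ} {Gate : ℕ → Prop} (hC : 0 ≤ C)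
    (hρ : ∀ k, 0 ≤ ρ k) (hc : ∀ k, 0 ≤ c k) (hbirth : T.BirthsFromOld C ρ σ Gate)
    (hrate : ∀ j k, j ≤ k → k < B.K → (ρ k + C * c k) * σ j k ≤ σ j (k + 1))
    (htr : T.TransportsFromVar C ρ Gate) (hreg : T.RegeneratesFromVar c Gate)
    (hgate : ∀ k, k < B.K → RanBelow Gate k → T.EnvBoundAtVar C ρ σ k → Gate k) :
    ∀ k, k ≤ B.K → T.EnvBoundAtVar C ρ σ k ∧ RanBelow Gate k := by
  intro k
  induction k with
  | zero =>
    intro _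
    refine ⟨fun b hb => ?_, ranBelow_zero Gate⟩
    have hb0 : B.birthScale b = 0 := Nat.le_zero.mp hb
    refine Trajectory.envVar_le_at_birth hb0 (hbirth b (hb.trans (Nat.zero_le _)) ?_ fun b₀ hb₀ => ?_)
    · rw [hb0]; exact ranBelow_zero Gate
    · rw [hb0] at hb₀; exact absurd hb₀ (Nat.not_lt_zero _)
  | succ k ih =>
    intro hk1
    have hk : k < B.K := Nat.lt_of_succ_le hk1
    obtain ⟨henv, hran⟩ := ih hk.le
    have hP : SizeBoundAt B σ k := Trajectory.sizeBoundAt_of_envBoundAtVar htr hk.le hran henv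
    have hran1 : RanBelow Gate (k + 1) := hran.succ (hgate k hk hran henv)
    have hold : ∀ b : B.Birth, B.birthScale b ≤ k → T.envVar C ρ b (k + 1) ≤ σ (B.birthScale b) (k + 1) := by
      intro b hbk
      rw [Trajectory.envVar_succ C ρ hbk]
      have h1 : T.envVar C ρ b k ≤ σ (B.birthScale b) k := henv b hbk
      have h2 : T.gen b (k + 1) ≤ c k * σ (B.birthScale b) k :=
        (hreg b k hbk hk hran1).trans (mul_le_mul_of_nonneg_left (hP b hbk) (hc k))
      calc ρ k * T.envVar C ρ b k + C * T.gen b (k + 1)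
          ≤ ρ k * σ (B.birthScale b) k + C * (c k * σ (B.birthScale b) k) :=
            add_le_add (mul_le_mul_of_nonneg_left h1 (hρ k)) (mul_le_mul_of_nonneg_left h2 hC)
        _ = (ρ k + C * c k) * σ (B.birthScale b) k := by ring
        _ ≤ σ (B.birthScale b) (k + 1) := hrate _ k hbk hk
    refine ⟨fun b hb => ?_, hran1⟩
    rcases Nat.lt_or_eq_of_le hb with hlt | heq
    · exact hold b (Nat.lt_succ_iff.mp hlt)
    · refine Trajectory.envVar_le_at_birth heq (hbirth b ?_ ?_ fun b₀ hb₀ => ?_)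
      · rw [heq]; exact hk1
      · rw [heq]; exact hran1
      · rw [heq] at hb₀ ⊢
        exact hold b₀ (Nat.lt_succ_iff.mp hb₀)

/-- **EVERY DRESSED BUDGET ALONG THE TRAJECTORY, K-FREE** (the scale-by-scale interleaving closed at booking level): births
from old, class compatibility `(ρ_k + C·c_k)·σ j k ≤ σ j (k+1)`, transport `TransportsFromVar C ρ (budgetGate …)` (what the gated
capstone delivers with THIS gate — its `hs` is `hs_of_budgetGate`), regeneration under the gate, and the data of
`budgetGate_of_envBound` at every scale `k < K` (constant-rate class bound, counts, strict product, action margin, K-FREE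
smallness) ⟹ for every `k ≤ K`: the envelope bound AND `RanBelow (budgetGate …) k`, i.e. the dressed budget
`s⁰ b i + m·Σ envVar ≤ 1` of EVERY family at EVERY earlier scale. [folklore] -/
theorem dressedBudget_closed {s₀ : B.Birth → ℕ → ℝ} {m C : ℝ} {S : ℕ → B.Birth → Finset B.Birth} {ρ c : ℕ → ℝ}
    {σ : ℕ → ℕ → ℝ} {A₀ ρ₁ τ Λ N₀ ρ' sbar : ℝ}
    (hC : 0 ≤ C) (hρ : ∀ k, 0 ≤ ρ k) (hc : ∀ k, 0 ≤ c k)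
    (hm : 0 ≤ m) (hA₀ : 0 ≤ A₀) (hρ₁ : 0 ≤ ρ₁) (hτ0 : 0 ≤ τ) (hτ1 : τ ≤ 1) (hΛ : 0 ≤ Λ) (hN₀ : 0 ≤ N₀)
    (hρ'1 : ρ' < 1) (hprod : Λ * ρ₁ * τ ≤ ρ')
    (hS : ∀ k b, ∀ f ∈ S k b, B.birthScale f ≤ k)
    (hcount : ∀ k b, ∀ j ≤ k, (((S k b).filter fun f => B.birthScale f = j).card : ℝ) ≤ N₀ * Λ ^ (k - j))
    (hσ : ∀ j k, j ≤ k → k < B.K → σ j k ≤ A₀ * ρ₁ ^ (k - j) * τ ^ (B.K - j))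
    (hs₀ : ∀ b k, s₀ b k ≤ sbar) (hsmall : m * (N₀ * A₀ * (1 - ρ')⁻¹) ≤ 1 - sbar)
    (hbirth : T.BirthsFromOld C ρ σ (budgetGate T s₀ m S C ρ))
    (hrate : ∀ j k, j ≤ k → k < B.K → (ρ k + C * c k) * σ j k ≤ σ j (k + 1))
    (htr : T.TransportsFromVar C ρ (budgetGate T s₀ m S C ρ))
    (hreg : T.RegeneratesFromVar c (budgetGate T s₀ m S C ρ)) :
    ∀ k, k ≤ B.K → T.EnvBoundAtVar C ρ σ k ∧ RanBelow (budgetGate T s₀ m S C ρ) k :=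
  envBoundAtVar_ranBelow_envGate hC hρ hc hbirth hrate htr hreg fun k hk _ henv =>
    budgetGate_of_envBound hm hA₀ hρ₁ hτ0 hτ1 hΛ hN₀ hρ'1 hprod hk.le (hS k) (hcount k)
      (fun j hj => hσ j k hj hk) (fun b => hs₀ b k) hsmall henv

end BudgetGate

end

end Summit.QuantumFields.BalabanUV.T4Continuum.T4TrajectoryDensityDressed
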